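import Summits.Ventures.PercRepro.K4LadderBase

/-!
# PercRepro — C-025 on `T_p(M(K₄) ⊕ U_{m,m})`: the arithmetic half, II — the levels and the theorem (p9, gen 13)

Second half of `K4LadderBase` (`proofs/P9-S4-LINELADDER-g13.md` §8): with `#U = 38·c_{q−3} + 19·c_{q−2} + 6·c_{q−1} + c_q`
and `#Y = Σ_{q<a<p} c_a + 6·Σ_{q≤a≤p−2} c_a + 19·Σ_{q−1≤a≤p−3} c_a + 38·Σ_{q−2≤a≤p−4} c_a` (`c_a = C(m, a)`),

* the levels `q = 0, 1, 2` (`k4_zero`, `k4_one`, `k4_two`) with their own `#U` (`1`, `6 + m`, `19 + 6m + C(m,2)`),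
  each by induction on `m` from the layer `m = p + q − 3`, descending one level by Pascal's rule and Lemma E;
* level `3` (`k4_three`) and every level `q = r + 3` (`k4_rs`): the base layer is `k4_base`, the step `m → m + 1`
  is `uK_succ` / `yK_succ` plus the lower level's inequality and Lemma E `phiK_succ_succ_le`;
* **`k4_ineq`**: `Φ(p,q)·#U ≤ #Y` for every `q ≥ 3`, `p ≥ q + 2`, `m ≥ p + q − 3`.

No matroid is mentioned (the bridge to `M(K₄)` is future work); nothing here is about the windows of S4.
-/

namespace PercRepro.LineLadder

open Finset

/-! ### The levels `q = 2, 1, 0` (with their own `#U`: `19 + 6m + C(m,2)`, `6 + m`, `1`) -/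

/-- Pascal for `#Y` at level `2` (`p ≥ 4`): the level-`1` count appears. -/
lemma yK_two_succ (s m : ℕ) :
    (∑ a ∈ Ico 3 (s + 4), (m + 1).choose a + 6 * ∑ a ∈ Ico 2 (s + 4 - 1), (m + 1).choose a
        + 19 * ∑ a ∈ Ico 1 (s + 4 - 2), (m + 1).choose a + 38 * ∑ a ∈ Ico 0 (s + 4 - 3), (m + 1).choose a : ℕ)
      = (∑ a ∈ Ico 3 (s + 4), m.choose a + 6 * ∑ a ∈ Ico 2 (s + 4 - 1), m.choose a
        + 19 * ∑ a ∈ Ico 1 (s + 4 - 2), m.choose a + 38 * ∑ a ∈ Ico 0 (s + 4 - 3), m.choose a : ℕ)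
        + (∑ a ∈ Ico 2 (s + 3), m.choose a + 6 * ∑ a ∈ Ico 1 (s + 3 - 1), m.choose a
        + 19 * ∑ a ∈ Ico 0 (s + 3 - 2), m.choose a + 38 * ∑ a ∈ Ico 0 (s + 3 - 3), m.choose a : ℕ) := by
  rw [sum_choose_succ' m 3 (s + 4) (by omega), sum_choose_succ' m 2 (s + 4 - 1) (by omega),
    sum_choose_succ' m 1 (s + 4 - 2) (by omega), sum_choose_succ_zero' m (s + 4 - 3) (by omega)]
  simp only [show (3 : ℕ) - 1 = 2 by omega, show (2 : ℕ) - 1 = 1 by omega, show (1 : ℕ) - 1 = 0 by omega,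
    show s + 4 - 1 = s + 3 by omega, show s + 4 - 2 = s + 2 by omega, show s + 4 - 3 = s + 1 by omega,
    show s + 3 - 1 = s + 2 by omega, show s + 3 - 2 = s + 1 by omega, show s + 3 - 3 = s by omega,
    show s + 2 - 1 = s + 1 by omega, show s + 1 - 1 = s by omega]
  ring

/-- Pascal for `#Y` at level `1` (`p ≥ 3`): the level-`0` count appears. -/
lemma yK_one_succ (s m : ℕ) :
    (∑ a ∈ Ico 2 (s + 3), (m + 1).choose a + 6 * ∑ a ∈ Ico 1 (s + 3 - 1), (m + 1).choose a
        + 19 * ∑ a ∈ Ico 0 (s + 3 - 2), (m + 1).choose a + 38 * ∑ a ∈ Ico 0 (s + 3 - 3), (m + 1).choose a : ℕ)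
      = (∑ a ∈ Ico 2 (s + 3), m.choose a + 6 * ∑ a ∈ Ico 1 (s + 3 - 1), m.choose a
        + 19 * ∑ a ∈ Ico 0 (s + 3 - 2), m.choose a + 38 * ∑ a ∈ Ico 0 (s + 3 - 3), m.choose a : ℕ)
        + (∑ a ∈ Ico 1 (s + 2), m.choose a + 6 * ∑ a ∈ Ico 0 (s + 2 - 1), m.choose a
        + 19 * ∑ a ∈ Ico 0 (s + 2 - 2), m.choose a + 38 * ∑ a ∈ Ico 0 (s + 2 - 3), m.choose a : ℕ) := by
  rcases s with _ | s
  · simp only [show (3 : ℕ) - 1 = 2 by omega, show (3 : ℕ) - 2 = 1 by omega, show (3 : ℕ) - 3 = 0 by omega, zero_add]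
    rw [sum_choose_succ' m 2 3 (by omega), sum_choose_succ' m 1 2 (by omega), sum_choose_succ_zero' m 1 (by omega)]
    simp only [show (2 : ℕ) - 1 = 1 by omega, show (3 : ℕ) - 1 = 2 by omega, show (1 : ℕ) - 1 = 0 by omega]
    simp
    ring
  · rw [sum_choose_succ' m 2 (s + 1 + 3) (by omega), sum_choose_succ' m 1 (s + 1 + 3 - 1) (by omega),
      sum_choose_succ_zero' m (s + 1 + 3 - 2) (by omega), sum_choose_succ_zero' m (s + 1 + 3 - 3) (by omega)]
    simp only [show (2 : ℕ) - 1 = 1 by omega, show (1 : ℕ) - 1 = 0 by omega, show s + 1 + 3 - 1 = s + 3 by omega,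
      show s + 1 + 3 - 2 = s + 2 by omega, show s + 1 + 3 - 3 = s + 1 by omega, show s + 1 + 2 - 1 = s + 2 by omega,
      show s + 1 + 2 - 2 = s + 1 by omega, show s + 1 + 2 - 3 = s by omega,
      show s + 2 - 1 = s + 1 by omega, show s + 1 - 1 = s by omega, show s + 1 + 2 = s + 3 by omega]
    ring

/-- The level-`0` count `#Y` is nondecreasing in `m` (every summand is). -/
lemma yK_zero_mono (s m : ℕ) :
    (∑ a ∈ Ico 1 (s + 2), m.choose a + 6 * ∑ a ∈ Ico 0 (s + 2 - 1), m.choose a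
        + 19 * ∑ a ∈ Ico 0 (s + 2 - 2), m.choose a + 38 * ∑ a ∈ Ico 0 (s + 2 - 3), m.choose a : ℕ)
      ≤ (∑ a ∈ Ico 1 (s + 2), (m + 1).choose a + 6 * ∑ a ∈ Ico 0 (s + 2 - 1), (m + 1).choose a
        + 19 * ∑ a ∈ Ico 0 (s + 2 - 2), (m + 1).choose a + 38 * ∑ a ∈ Ico 0 (s + 2 - 3), (m + 1).choose a : ℕ) := by
  have h := fun (u v : ℕ) => Finset.sum_le_sum (fun a (_ : a ∈ Ico u v) => Nat.choose_le_succ m a)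
  exact Nat.add_le_add (Nat.add_le_add (Nat.add_le_add (h _ _) (Nat.mul_le_mul_left 6 (h _ _)))
    (Nat.mul_le_mul_left 19 (h _ _))) (Nat.mul_le_mul_left 38 (h _ _))

/-- Level `0` (`p = t + 3`, `#U = 1`): `Φ(p, 0) ≤ #Y` for every `m ≥ t`. -/
theorem k4_zero (t m : ℕ) (hm : t ≤ m) :
    phiK (t + 3) 0 ≤ ((∑ a ∈ Ico 1 (t + 3), m.choose a + 6 * ∑ a ∈ Ico 0 (t + 2), m.choose a
        + 19 * ∑ a ∈ Ico 0 (t + 1), m.choose a + 38 * ∑ a ∈ Ico 0 t, m.choose a : ℕ) : ℚ) := by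
  have hbase : phiK (t + 3) 0 ≤ ((∑ a ∈ Ico 1 (t + 3), t.choose a + 6 * ∑ a ∈ Ico 0 (t + 2), t.choose a
        + 19 * ∑ a ∈ Ico 0 (t + 1), t.choose a + 38 * ∑ a ∈ Ico 0 t, t.choose a : ℕ) : ℚ) := by
    have hnum : ∑ u ∈ Ioo 0 (t + 3), (t + 3).choose u
        = ∑ a ∈ Ico 1 (t + 3), t.choose a + 3 * ∑ a ∈ Ico 0 (t + 2), t.choose a
          + 3 * ∑ a ∈ Ico 0 (t + 1), t.choose a + ∑ a ∈ Ico 0 t, t.choose a := by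
      rw [Ioo_eq_Ico', show (0 : ℕ) + 1 = 1 by rfl, show t + 3 = (t + 2) + 1 by rfl,
        sum_choose_succ' (t + 2) 1 (t + 2 + 1) (by omega), show (1 : ℕ) - 1 = 0 by rfl,
        show t + 2 + 1 - 1 = t + 2 by omega, show t + 2 = (t + 1) + 1 by rfl,
        sum_choose_succ' (t + 1) 1 (t + 1 + 1 + 1) (by omega), show (1 : ℕ) - 1 = 0 by rfl,
        show t + 1 + 1 + 1 - 1 = t + 1 + 1 by omega, sum_choose_succ_zero' (t + 1) (t + 1 + 1) (by omega),
        show t + 1 + 1 - 1 = t + 1 by omega, show t + 1 = t + 1 by rfl,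
        sum_choose_succ' t 1 (t + 1 + 1 + 1) (by omega), show (1 : ℕ) - 1 = 0 by rfl,
        show t + 1 + 1 + 1 - 1 = t + 1 + 1 by omega, sum_choose_succ_zero' t (t + 1 + 1) (by omega),
        show t + 1 + 1 - 1 = t + 1 by omega, sum_choose_succ_zero' t (t + 1) (by omega), show t + 1 - 1 = t by omega]
      ring
    unfold phiK
    rw [show t + 3 + 0 = t + 3 by rfl, Nat.choose_self, Nat.cast_one, div_one, ← Nat.cast_sum, hnum]
    exact_mod_cast (by omega : ∑ a ∈ Ico 1 (t + 3), t.choose a + 3 * ∑ a ∈ Ico 0 (t + 2), t.choose a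
      + 3 * ∑ a ∈ Ico 0 (t + 1), t.choose a + ∑ a ∈ Ico 0 t, t.choose a
      ≤ ∑ a ∈ Ico 1 (t + 3), t.choose a + 6 * ∑ a ∈ Ico 0 (t + 2), t.choose a
      + 19 * ∑ a ∈ Ico 0 (t + 1), t.choose a + 38 * ∑ a ∈ Ico 0 t, t.choose a)
  refine Nat.le_induction hbase (fun m' _ ih => ih.trans ?_) m hm
  have := yK_zero_mono (t + 1) m'
  simp only [show t + 1 + 2 = t + 3 by omega, show t + 1 + 2 - 1 = t + 2 by omega, show t + 1 + 2 - 2 = t + 1 by omega,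
    show t + 1 + 2 - 3 = t by omega] at this
  exact_mod_cast this

/-- Level `1` (`p = s + 3`, `#U = 6 + m`): for every `m ≥ s + 1`. -/
theorem k4_one (s m : ℕ) (hm : s + 1 ≤ m) :
    phiK (s + 3) 1 * ((6 + m : ℕ) : ℚ) ≤ ((∑ a ∈ Ico 2 (s + 3), m.choose a + 6 * ∑ a ∈ Ico 1 (s + 3 - 1), m.choose a
        + 19 * ∑ a ∈ Ico 0 (s + 3 - 2), m.choose a + 38 * ∑ a ∈ Ico 0 (s + 3 - 3), m.choose a : ℕ) : ℚ) := by
  have hbase : phiK (s + 3) 1 * ((6 + (s + 1) : ℕ) : ℚ)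
      ≤ ((∑ a ∈ Ico 2 (s + 3), (s + 1).choose a + 6 * ∑ a ∈ Ico 1 (s + 3 - 1), (s + 1).choose a
        + 19 * ∑ a ∈ Ico 0 (s + 3 - 2), (s + 1).choose a + 38 * ∑ a ∈ Ico 0 (s + 3 - 3), (s + 1).choose a : ℕ) : ℚ) := by
    set A := ∑ a ∈ Ico 2 (s + 3), (s + 1).choose a with hA
    set B := ∑ a ∈ Ico 1 (s + 2), (s + 1).choose a with hB
    set Cc := ∑ a ∈ Ico 0 (s + 1), (s + 1).choose a with hCc
    set D := ∑ a ∈ Ico 0 s, (s + 1).choose a with hD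
    have hnum : ∑ u ∈ Ioo 1 (s + 3), (s + 1 + 3).choose u = A + 3 * B + 3 * Cc + D := by
      rw [Ioo_eq_Ico', show (1 : ℕ) + 1 = 2 by rfl, show s + 1 + 3 = (s + 1 + 2) + 1 by rfl,
        sum_choose_succ' (s + 1 + 2) 2 (s + 3) (by omega), show (2 : ℕ) - 1 = 1 by rfl, show s + 3 - 1 = s + 2 by omega,
        show s + 1 + 2 = (s + 1 + 1) + 1 by rfl, sum_choose_succ' (s + 1 + 1) 2 (s + 3) (by omega),
        show (2 : ℕ) - 1 = 1 by rfl, show s + 3 - 1 = s + 2 by omega, sum_choose_succ' (s + 1 + 1) 1 (s + 2) (by omega),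
        show (1 : ℕ) - 1 = 0 by rfl, show s + 2 - 1 = s + 1 by omega,
        sum_choose_succ' (s + 1) 2 (s + 3) (by omega), show (2 : ℕ) - 1 = 1 by rfl, show s + 3 - 1 = s + 2 by omega,
        sum_choose_succ' (s + 1) 1 (s + 2) (by omega), show (1 : ℕ) - 1 = 0 by rfl, show s + 2 - 1 = s + 1 by omega,
        sum_choose_succ_zero' (s + 1) (s + 1) (by omega), show s + 1 - 1 = s by omega]
      ring
    have hY : (∑ a ∈ Ico 2 (s + 3), (s + 1).choose a + 6 * ∑ a ∈ Ico 1 (s + 3 - 1), (s + 1).choose a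
        + 19 * ∑ a ∈ Ico 0 (s + 3 - 2), (s + 1).choose a + 38 * ∑ a ∈ Ico 0 (s + 3 - 3), (s + 1).choose a : ℕ)
        = A + 6 * B + 19 * Cc + 38 * D := by
      simp only [show s + 3 - 1 = s + 2 by omega, show s + 3 - 2 = s + 1 by omega, show s + 3 - 3 = s by omega]
      rfl
    have hAtop : A = ∑ a ∈ Ico 2 (s + 2), (s + 1).choose a := by
      rw [hA, Finset.sum_Ico_succ_top (show 2 ≤ s + 2 by omega),
        Nat.choose_eq_zero_of_lt (show s + 1 < s + 2 by omega), add_zero]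
    have hAD : A = D := by
      rw [hAtop, hD, sum_choose_reflect (s + 1) 2 (s + 2) (by omega)]
      rw [show s + 1 + 1 - (s + 2) = 0 by omega, show s + 1 + 1 - 2 = s by omega]
    have hBC : B = Cc := by
      rw [hB, hCc, sum_choose_reflect (s + 1) 1 (s + 2) (by omega)]
      rw [show s + 1 + 1 - (s + 2) = 0 by omega, show s + 1 + 1 - 1 = s + 1 by omega]
    have hBA : B = A + (s + 1) := by
      rw [hB, hAtop, Finset.sum_eq_sum_Ico_succ_bot (show 1 < s + 2 by omega), Nat.choose_one_right]
      ring
    unfold phiK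
    rw [show s + 3 + 1 = s + 1 + 3 by rfl, ← Nat.cast_sum, hnum, hY,
      show (s + 1 + 3).choose (s + 3) = s + 4 from by
        rw [show s + 1 + 3 = (s + 3) + 1 by rfl]; exact Nat.choose_succ_self_right (s + 3)]
    have hpos : (0 : ℚ) < ((s + 4 : ℕ) : ℚ) := by positivity
    rw [div_mul_eq_mul_div, div_le_iff₀ hpos]
    have qAD : (A : ℚ) = D := by exact_mod_cast hAD
    have qBC : (B : ℚ) = Cc := by exact_mod_cast hBC
    have qBA : (B : ℚ) = A + (s + 1) := by exact_mod_cast hBA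
    have qA : (0 : ℚ) ≤ A := by positivity
    have qs : (0 : ℚ) ≤ s := by positivity
    push_cast
    nlinarith [mul_nonneg qA qs]
  refine Nat.le_induction hbase (fun m' hm' ih => ?_) m hm
  have hE : phiK (s + 3) 1 ≤ phiK (s + 2) 0 := phiK_succ_succ_le (s + 2) 0
  have hY := yK_one_succ s m'
  rw [hY, show 6 + (m' + 1) = (6 + m') + 1 by omega]
  -- level 0 at `p − 1 = s + 2`
  have h0 : phiK (s + 2) 0 ≤ ((∑ a ∈ Ico 1 (s + 2), m'.choose a + 6 * ∑ a ∈ Ico 0 (s + 2 - 1), m'.choose a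
      + 19 * ∑ a ∈ Ico 0 (s + 2 - 2), m'.choose a + 38 * ∑ a ∈ Ico 0 (s + 2 - 3), m'.choose a : ℕ) : ℚ) := by
    rcases s with _ | s
    · have h20 : phiK 2 0 = 2 := by
        unfold phiK
        rw [show Finset.Ioo 0 2 = {1} by decide]
        norm_num [Nat.choose_one_right]
      rw [h20]
      simp only [zero_add, show (2 : ℕ) - 1 = 1 by rfl, show (2 : ℕ) - 2 = 0 by rfl]
      have : (1 : ℕ) ≤ ∑ a ∈ Ico 0 1, m'.choose a := by simp
      have h2 : (2 : ℕ) ≤ ∑ a ∈ Ico 1 2, m'.choose a + 6 * ∑ a ∈ Ico 0 1, m'.choose a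
          + 19 * ∑ a ∈ Ico 0 0, m'.choose a + 38 * ∑ a ∈ Ico 0 0, m'.choose a := by omega
      exact_mod_cast h2
    · have := k4_zero s m' (by omega)
      simpa [show s + 1 + 2 = s + 3 by omega, show s + 1 + 2 - 1 = s + 2 by omega, show s + 1 + 2 - 2 = s + 1 by omega,
        show s + 1 + 2 - 3 = s by omega] using this
  push_cast at ih h0 ⊢
  nlinarith [ih, h0, hE, phiK_nonneg (s + 3) 1]


/-- Pascal for `#U` at level `2` (`19 + 6m + C(m,2)`): the level-`1` count `6 + m` appears. -/
lemma uK_two_succ (m : ℕ) :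
    (19 * (m + 1).choose 0 + 6 * (m + 1).choose 1 + (m + 1).choose 2 : ℕ)
      = (19 * m.choose 0 + 6 * m.choose 1 + m.choose 2 : ℕ) + (6 + m) := by
  simp only [Nat.choose_zero_right, Nat.choose_succ_succ']
  rw [Nat.choose_one_right]
  ring

/-- Level `2` (`p = s + 4`, `#U = 19 + 6m + C(m,2)`): for every `m ≥ s + 3`. -/
theorem k4_two (s m : ℕ) (hm : s + 3 ≤ m) :
    phiK (s + 4) 2 * ((19 * m.choose 0 + 6 * m.choose 1 + m.choose 2 : ℕ) : ℚ)
      ≤ ((∑ a ∈ Ico 3 (s + 4), m.choose a + 6 * ∑ a ∈ Ico 2 (s + 4 - 1), m.choose a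
        + 19 * ∑ a ∈ Ico 1 (s + 4 - 2), m.choose a + 38 * ∑ a ∈ Ico 0 (s + 4 - 3), m.choose a : ℕ) : ℚ) := by
  have hbase : phiK (s + 4) 2 * ((19 * (s + 3).choose 0 + 6 * (s + 3).choose 1 + (s + 3).choose 2 : ℕ) : ℚ)
      ≤ ((∑ a ∈ Ico 3 (s + 4), (s + 3).choose a + 6 * ∑ a ∈ Ico 2 (s + 4 - 1), (s + 3).choose a
        + 19 * ∑ a ∈ Ico 1 (s + 4 - 2), (s + 3).choose a + 38 * ∑ a ∈ Ico 0 (s + 4 - 3), (s + 3).choose a : ℕ) : ℚ) := by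
    set K := s + 3 with hK
    set A := ∑ a ∈ Ico 3 (s + 4), K.choose a with hA
    set B := ∑ a ∈ Ico 2 (s + 3), K.choose a with hB
    set Cc := ∑ a ∈ Ico 1 (s + 2), K.choose a with hCc
    set D := ∑ a ∈ Ico 0 (s + 1), K.choose a with hD
    have hnum : ∑ u ∈ Ioo 2 (s + 4), (K + 3).choose u = A + 3 * B + 3 * Cc + D := by
      rw [Ioo_eq_Ico', show (2 : ℕ) + 1 = 3 by rfl, show K + 3 = (K + 2) + 1 by rfl,
        sum_choose_succ' (K + 2) 3 (s + 4) (by omega), show (3 : ℕ) - 1 = 2 by rfl, show s + 4 - 1 = s + 3 by omega,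
        show K + 2 = (K + 1) + 1 by rfl, sum_choose_succ' (K + 1) 3 (s + 4) (by omega), show (3 : ℕ) - 1 = 2 by rfl,
        show s + 4 - 1 = s + 3 by omega, sum_choose_succ' (K + 1) 2 (s + 3) (by omega), show (2 : ℕ) - 1 = 1 by rfl,
        show s + 3 - 1 = s + 2 by omega, sum_choose_succ' K 3 (s + 4) (by omega), show (3 : ℕ) - 1 = 2 by rfl,
        show s + 4 - 1 = s + 3 by omega, sum_choose_succ' K 2 (s + 3) (by omega), show (2 : ℕ) - 1 = 1 by rfl,
        show s + 3 - 1 = s + 2 by omega, sum_choose_succ' K 1 (s + 2) (by omega), show (1 : ℕ) - 1 = 0 by rfl,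
        show s + 2 - 1 = s + 1 by omega]
      ring
    have hden : (K + 3).choose (s + 4) = 3 + 3 * K + K.choose 2 := by
      have a1 := Nat.choose_succ_succ' (K + 2) (s + 3)
      have a2 := Nat.choose_succ_succ' (K + 1) (s + 2)
      have a3 := Nat.choose_succ_succ' (K + 1) (s + 3)
      have a4 := Nat.choose_succ_succ' K (s + 1)
      have a5 := Nat.choose_succ_succ' K (s + 2)
      have e1 : K.choose (s + 1) = K.choose 2 := by
        rw [show s + 1 = K - 2 by omega, Nat.choose_symm (show 2 ≤ K by omega)]
      have e2 : K.choose (s + 2) = K := by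
        rw [show s + 2 = K - 1 by omega, Nat.choose_symm (show 1 ≤ K by omega), Nat.choose_one_right]
      have e3 : K.choose (s + 3) = 1 := by rw [show s + 3 = K by rfl]; exact Nat.choose_self K
      have e4 : (K + 1).choose (s + 4) = 1 := by rw [show s + 4 = K + 1 by omega]; exact Nat.choose_self (K + 1)
      simp only [show K + 2 + 1 = K + 3 by omega, show K + 1 + 1 = K + 2 by omega, show s + 3 + 1 = s + 4 by omega,
        show s + 2 + 1 = s + 3 by omega, show s + 1 + 1 = s + 2 by omega] at a1 a2 a3 a4 a5
      omega
    have hphi : phiK (s + 4) 2 = ((A + 3 * B + 3 * Cc + D : ℕ) : ℚ) / ((3 + 3 * K + K.choose 2 : ℕ) : ℚ) := by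
      unfold phiK
      rw [show s + 4 + 2 = K + 3 by omega, ← hden, ← hnum, Nat.cast_sum]
    have hY : (∑ a ∈ Ico 3 (s + 4), K.choose a + 6 * ∑ a ∈ Ico 2 (s + 4 - 1), K.choose a
        + 19 * ∑ a ∈ Ico 1 (s + 4 - 2), K.choose a + 38 * ∑ a ∈ Ico 0 (s + 4 - 3), K.choose a : ℕ)
        = A + 6 * B + 19 * Cc + 38 * D := by
      simp only [show s + 4 - 1 = s + 3 by omega, show s + 4 - 2 = s + 2 by omega, show s + 4 - 3 = s + 1 by omega]
      rfl
    have hAD : A = D := by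
      rw [hA, hD, sum_choose_reflect K 3 (s + 4) (by omega)]
      rw [show K + 1 - (s + 4) = 0 by omega, show K + 1 - 3 = s + 1 by omega]
    have hBC : B = Cc := by
      rw [hB, hCc, sum_choose_reflect K 2 (s + 3) (by omega)]
      rw [show K + 1 - (s + 3) = 1 by omega, show K + 1 - 2 = s + 2 by omega]
    have hBA : B + 1 = A + K.choose 2 := by
      have hA' : A = ∑ a ∈ Ico 3 (s + 3), K.choose a + 1 := by
        rw [hA, Finset.sum_Ico_succ_top (show 3 ≤ s + 3 by omega), show K.choose (s + 3) = 1 from Nat.choose_self K]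
      have hB' : B = K.choose 2 + ∑ a ∈ Ico 3 (s + 3), K.choose a := by
        rw [hB, Finset.sum_eq_sum_Ico_succ_bot (show 2 < s + 3 by omega)]
      omega
    have hU : (19 * K.choose 0 + 6 * K.choose 1 + K.choose 2 : ℕ) = 19 + 6 * K + K.choose 2 := by
      rw [Nat.choose_zero_right, Nat.choose_one_right]
    have hc0 : 3 ≤ K.choose 2 := by
      have := Nat.choose_le_choose 2 (show 3 ≤ K by omega)
      simpa using this
    rw [hphi, hU, hY]
    have hpos : (0 : ℚ) < ((3 + 3 * K + K.choose 2 : ℕ) : ℚ) := by positivity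
    rw [div_mul_eq_mul_div, div_le_iff₀ hpos]
    have qAD : (A : ℚ) = D := by exact_mod_cast hAD
    have qBC : (B : ℚ) = Cc := by exact_mod_cast hBC
    have qBA : (B : ℚ) + 1 = A + K.choose 2 := by exact_mod_cast hBA
    have qc0 : (3 : ℚ) ≤ K.choose 2 := by exact_mod_cast hc0
    have qA : (0 : ℚ) ≤ A := by positivity
    have qK : (3 : ℚ) ≤ K := by rw [hK]; push_cast; linarith
    push_cast
    nlinarith [mul_nonneg qA (sub_nonneg.2 qc0), mul_nonneg qA (sub_nonneg.2 qK),
      mul_nonneg (sub_nonneg.2 qc0) (sub_nonneg.2 qK), mul_nonneg (sub_nonneg.2 qc0) (sub_nonneg.2 qc0)]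
  refine Nat.le_induction hbase (fun m' hm' ih => ?_) m hm
  have hE : phiK (s + 4) 2 ≤ phiK (s + 3) 1 := phiK_succ_succ_le (s + 3) 1
  have h1 := k4_one s m' (by omega)
  rw [yK_two_succ s m', uK_two_succ m']
  have hnn : (0 : ℚ) ≤ ((6 + m' : ℕ) : ℚ) := by positivity
  have hmul := mul_le_mul_of_nonneg_right hE hnn
  push_cast at ih h1 hmul ⊢
  nlinarith [ih, h1, hmul]

/-! ### The theorem at every level `q ≥ 3` -/

/-- Level `q = 3`, `p = s + 5`, every `m ≥ s + 5`: induction on `m` from `k4_base 0 s`, descending to level `2`. -/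
theorem k4_three (s m : ℕ) (hm : s + 5 ≤ m) :
    phiK (s + 5) 3 * ((38 * m.choose 0 + 19 * m.choose 1 + 6 * m.choose 2 + m.choose 3 : ℕ) : ℚ)
      ≤ ((∑ a ∈ Ico 4 (s + 5), m.choose a + 6 * ∑ a ∈ Ico 3 (s + 5 - 1), m.choose a
        + 19 * ∑ a ∈ Ico 2 (s + 5 - 2), m.choose a + 38 * ∑ a ∈ Ico 1 (s + 5 - 3), m.choose a : ℕ) : ℚ) := by
  refine Nat.le_induction (by simpa using k4_base 0 s) (fun m' hm' ih => ?_) m hm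
  have h2 := k4_two s m' (by omega)
  have hE : phiK (s + 5) 3 ≤ phiK (s + 4) 2 := phiK_succ_succ_le (s + 4) 2
  have hU := uK_three_succ m'
  have hY := yK_succ 0 (s + 1) m'
  simp only [show (0 : ℕ) + 3 = 3 by rfl, show (3 : ℕ) + 1 = 4 by rfl, show (3 : ℕ) - 1 = 2 by rfl,
    show (3 : ℕ) - 2 = 1 by rfl, show (0 : ℕ) + 2 = 2 by rfl, show (2 : ℕ) - 2 = 0 by rfl,
    show s + 1 + 4 = s + 5 by omega, show s + 1 + 3 = s + 4 by omega] at hY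
  rw [hY, hU]
  have hnn : (0 : ℚ) ≤ ((19 * m'.choose 0 + 6 * m'.choose 1 + m'.choose 2 : ℕ) : ℚ) := by positivity
  have hmul := mul_le_mul_of_nonneg_right hE hnn
  push_cast at ih h2 hmul ⊢
  nlinarith [ih, h2, hmul]

/-- The `K₄` inequality at level `q = r + 3`, rank `p = r + s + 5`, for every `m ≥ p + q − 3 = 2r + s + 5`:
outer induction on `r` (level `3` is `k4_three`), inner induction on `m` from `k4_base`, each `m`-step descending
one level by Pascal's rule and Lemma E. -/
theorem k4_rs (r s : ℕ) :
    ∀ m, 2 * r + s + 5 ≤ m →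
      phiK (r + s + 5) (r + 3) *
          ((38 * m.choose (r + 3 - 3) + 19 * m.choose (r + 3 - 2) + 6 * m.choose (r + 3 - 1) + m.choose (r + 3) : ℕ) : ℚ)
        ≤ ((∑ a ∈ Ico (r + 3 + 1) (r + s + 5), m.choose a + 6 * ∑ a ∈ Ico (r + 3) (r + s + 5 - 1), m.choose a
            + 19 * ∑ a ∈ Ico (r + 3 - 1) (r + s + 5 - 2), m.choose a
            + 38 * ∑ a ∈ Ico (r + 3 - 2) (r + s + 5 - 3), m.choose a : ℕ) : ℚ) := by
  induction r with
  | zero =>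
    intro m hm
    simpa using k4_three s m (by omega)
  | succ r ih =>
    intro m hm
    refine Nat.le_induction (by simpa using k4_base (r + 1) s) (fun m' hm' ih' => ?_) m hm
    have hlow := ih m' (by omega)
    have hE : phiK (r + s + 6) (r + 4) ≤ phiK (r + s + 5) (r + 3) := by
      have h := phiK_succ_succ_le (r + s + 5) (r + 3)
      simp only [show r + s + 5 + 1 = r + s + 6 by omega, show r + 3 + 1 = r + 4 by omega] at h
      exact h
    have hU := uK_succ r m'
    have hY := yK_succ (r + 1) (r + s + 2) m'
    simp only [show r + 1 + 3 = r + 4 by omega, show r + s + 2 + 4 = r + s + 6 by omega,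
      show r + 1 + 2 = r + 3 by omega, show r + s + 2 + 3 = r + s + 5 by omega] at hY
    simp only [show r + 1 + 3 = r + 4 by omega, show r + 1 + s + 5 = r + s + 6 by omega] at ih' ⊢
    rw [hY, hU]
    have hnn : (0 : ℚ) ≤ ((38 * m'.choose (r + 3 - 3) + 19 * m'.choose (r + 3 - 2) + 6 * m'.choose (r + 3 - 1)
        + m'.choose (r + 3) : ℕ) : ℚ) := by positivity
    have hmul := mul_le_mul_of_nonneg_right hE hnn
    push_cast at ih' hlow hmul ⊢
    nlinarith [ih', hlow, hmul]

/-- **THE K₄ INEQUALITY ON THE ACTIVE LAYERS** (the arithmetic half of P9-S4-LINELADDER-g13.md §8): for every level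
`q ≥ 3`, every `p ≥ q + 2` and every `m ≥ p + q − 3`,
`Φ(p,q) · (38·C(m,q−3) + 19·C(m,q−2) + 6·C(m,q−1) + C(m,q)) ≤ Σ_{q<a<p} C(m,a) + 6·Σ_{q≤a≤p−2} C(m,a) + 19·Σ_{q−1≤a≤p−3} C(m,a) + 38·Σ_{q−2≤a≤p−4} C(m,a)`
— the two sides being `#U` and `#Y` of `T_p(M(K₄) ⊕ U_{m,m})` at `(p, q)` on the layers where every orbit is active
(the matroid bridge is not in this file). -/
theorem k4_ineq (p q m : ℕ) (hq : 3 ≤ q) (hpq : q + 2 ≤ p) (hm : p + q - 3 ≤ m) :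
    phiK p q * ((38 * m.choose (q - 3) + 19 * m.choose (q - 2) + 6 * m.choose (q - 1) + m.choose q : ℕ) : ℚ)
      ≤ ((∑ a ∈ Ico (q + 1) p, m.choose a + 6 * ∑ a ∈ Ico q (p - 1), m.choose a
          + 19 * ∑ a ∈ Ico (q - 1) (p - 2), m.choose a + 38 * ∑ a ∈ Ico (q - 2) (p - 3), m.choose a : ℕ) : ℚ) := by
  obtain ⟨r, rfl⟩ : ∃ r, q = r + 3 := ⟨q - 3, by omega⟩
  obtain ⟨s, rfl⟩ : ∃ s, p = r + s + 5 := ⟨p - r - 5, by omega⟩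
  exact k4_rs r s m (by omega)

end PercRepro.LineLadder
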